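import Literature.NumberTheory.Automorphic.LocalTestFunctionTestClass
import Literature.NumberTheory.Automorphic.GLnPlacesSplittingOperators
import Literature.NumberTheory.Automorphic.GLnLocalPiIntegratedOperator
import Literature.NumberTheory.Automorphic.UnipotentAveragesLocalPlace
import HarnessLib

/-!
# Product test functions `Ξ ⊗ θ` along `GL_n(𝔸_K) = G_S × G^S` are test functions of supercusp type
(Gelbart, *Automorphic forms on adele groups* (1975), §10, p. 153: `Φ = (∏_{v ∈ S} f_v) × f`;
Garrett, *Modern analysis of automorphic forms by example* (2018), §6.3, §7.3: test functions
`f_∞ ⊗ f_fin` with `f_fin` locally constant of compact support; Jacquet–Langlands (1970), §16,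
p. 503: supercusp forms at the places of `S`)

Topic `NumberTheory/Automorphic`; theorems only (no definition, no named fact, no instance
visible to importers). The multi-place version of `LocalTestFunctionTestClass`: for a finite set
`S` of finite places, the product test functions
`Φ_{Ξ,θ}(g) = θ(s_S g) · Ξ(g_S)` of `GLnPlacesSplittingOperators` (`GLn.placesTestFunction`;
`s_S(g) = g ι_S(g_S)⁻¹` the part of `g` away from `S`) are shown to lie in the class
`IsTestFunctionGL` of the trace formula of the tree (`GL2TraceFormulaModParabolic`,
`GLnSupercuspTypeHilbertSchmidt`) and to be of supercusp type:

* `GLn.awayFromPlaces_mul`, `GLn.awayFromPlaces_ofInfinite`,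
  `GLn.toAdelicPi_toLocalAt_mem_principalCongruenceLevel`,
  `GLn.awayFromPlaces_mem_principalCongruenceLevel` — the algebra of `s_S`: it is multiplicative,
  fixes archimedean elements, and `K(𝔫)` is stable under `u ↦ ι_S(u_S)` and `u ↦ s_S(u)`.
* `IsTestFunctionGL.awayFromPlaces_mul_localPi` — **`g ↦ θ(s_S g) c(g_S)` is a test function**
  for `θ` a (real) test function on `GL_n(𝔸_K)` and `c : G_S → ℝ` right invariant under an open
  subgroup of `G_S = ∏_{v ∈ S} GL_n(K_v)` and of compact support (Garrett §7.3).
* `exists_isTestFunctionGL_placesTestFunction` — hence `Φ_{Ξ,θ} = η₁ + i η₂` with test functions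
  `η₁`, `η₂` for complex `Ξ` right invariant under an open subgroup and compactly supported.
* `GLn.tensorCc_mul_of_mem_pi`, `GLn.exists_isOpen_tensorCc_mul_eq`,
  `exists_isTestFunctionGL_placesTestFunction_tensorCc` — the case `Ξ = ⊗_{v ∈ S} ξ_v`
  (`GLn.tensorCc`) with each `ξ_v` right invariant under an open subgroup of `GL_n(K_v)`: the
  shape in which `exists_ramifiedFactor_family` (`SupercuspidalIdempotentLocalComponent`) delivers
  Gelbart's fixed ramified factors.
* `GLn.awayFromPlaces_toAdelic_of_mem`, `GLn.placesTestFunction_tensorCc_mul_toAdelic_mul`,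
  `integral_placesTestFunction_tensorCc_comp_glUnipotent_eq_zero` — **`(⊗ ξ_v) ⊗ θ` has vanishing
  unipotent averages `∫_{𝔫_k(𝔸_K)} Φ(p (1 + Y) r) dY = 0` as soon as one `ξ_w`, `w ∈ S`, is a
  supercusp form at level `k`** (`integral_comp_glUnipotent_eq_zero_of_place`; Jacquet–Langlands
  p. 503), the hypothesis `hΦ0` of `GL2.traceFormula_mod_parabolic` and of
  `integratedOperator_rightRegular_mem_cuspidalSubspace_of_place`.

Part of the inline (D-0026) decomposition of
`Literature.NumberTheory.Automorphic.jacquetLanglands_transfer_surjective` (Gelbart Thm. 10.5 (ii)):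
with `JacquetLanglandsSurjectiveSupercuspidalFactors` the `GL`-side test functions `Ξ ⊗ θ` of the
comparison are in the class for which the tree's trace formula is stated.

## References

* S. Gelbart, *Automorphic forms on adele groups*, Ann. of Math. Studies 83 (1975), §10, p. 153
  [Gelbart1975].
* P. Garrett, *Modern analysis of automorphic forms by example*, Vol. 1 (2018), §6.3, §7.3
  [Garrett2018].
* H. Jacquet, R. P. Langlands, *Automorphic forms on `GL(2)`*, LNM 114 (1970), §16, p. 503
  [JacquetLanglands1970].
-/

noncomputable section

-- `IsArchSmooth` is phrased through the matrix Lie algebra of `GL_n(K_∞)` (needs `LieRing` on the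
-- index types of `mixedSpace K`)
attribute [local instance 100] LieRing.ofAssociativeRing

open scoped MatrixGroups Matrix ContDiff NNReal Classical
open MeasureTheory Set Filter IsDedekindDomain NumberField NumberField.mixedEmbedding CompactlySupported
open _root_.Topology

namespace Literature.NumberTheory.Automorphic

/-! ### The algebra of the part away from `S` -/

section Algebra

variable {n : ℕ} {K : Type} [Field K] [NumberField K] {S : Finset (HeightOneSpectrum (𝓞 K))}

/-- `(g h)_S = g_S h_S` for the `S`-components `g_S = ((g)_v)_{v ∈ S} ∈ G_S`. [folklore] -/
theorem GLn.localPi_toLocalAt_mul (g h : (AdelicGroupData.gl n K).Adelic) :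
    (fun v : S => GLn.toLocalAt n K (v : HeightOneSpectrum (𝓞 K)) (g * h)) =
      (fun v : S => GLn.toLocalAt n K (v : HeightOneSpectrum (𝓞 K)) g) *
        fun v : S => GLn.toLocalAt n K (v : HeightOneSpectrum (𝓞 K)) h :=
  funext fun _ => map_mul _ g h

/-- **`s_S` is multiplicative**: `s_S(g h) = s_S(g) s_S(h)` — `s_S(h) = h ι_S(h_S)⁻¹ ∈ G^S` commutes
with `ι_S(G_S)`. [folklore] -/
theorem GLn.awayFromPlaces_mul (g h : (AdelicGroupData.gl n K).Adelic) :
    GLn.awayFromPlaces n K S (g * h) = GLn.awayFromPlaces n K S g * GLn.awayFromPlaces n K S h := by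
  have hcomm := GLn.toAdelicPi_mul_eq_mul_of_mem_trivialAt
    (GLn.awayFromPlaces_mem_trivialAt (n := n) (K := K) (S := S) h)
    (fun v : S => GLn.toLocalAt n K (v : HeightOneSpectrum (𝓞 K)) g)⁻¹
  rw [map_inv] at hcomm
  rw [show GLn.awayFromPlaces n K S (g * h) = g * h *
      (GLn.toAdelicPi n K S fun v : S => GLn.toLocalAt n K (v : HeightOneSpectrum (𝓞 K)) (g * h))⁻¹
      from rfl,
    show GLn.awayFromPlaces n K S g = g *
      (GLn.toAdelicPi n K S fun v : S => GLn.toLocalAt n K (v : HeightOneSpectrum (𝓞 K)) g)⁻¹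
      from rfl,
    GLn.localPi_toLocalAt_mul, map_mul, mul_inv_rev, mul_assoc g _ (GLn.awayFromPlaces n K S h), hcomm,
    show GLn.awayFromPlaces n K S h = h *
      (GLn.toAdelicPi n K S fun v : S => GLn.toLocalAt n K (v : HeightOneSpectrum (𝓞 K)) h)⁻¹
      from rfl]
  simp only [mul_assoc]

/-- `(g h)_S = g_S h_S`, spelled for the type `GL (Fin n) (AdeleRing (𝓞 K) K)` of the arguments of test
functions. [folklore] -/
theorem GLn.localPi_toLocalAt_mul' (g h : GL (Fin n) (AdeleRing (𝓞 K) K)) :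
    (fun v : S => GLn.toLocalAt n K (v : HeightOneSpectrum (𝓞 K)) (g * h)) =
      (fun v : S => GLn.toLocalAt n K (v : HeightOneSpectrum (𝓞 K)) g) *
        fun v : S => GLn.toLocalAt n K (v : HeightOneSpectrum (𝓞 K)) h :=
  GLn.localPi_toLocalAt_mul g h

/-- `s_S(g h) = s_S(g) s_S(h)`, spelled for the type `GL (Fin n) (AdeleRing (𝓞 K) K)`. [folklore] -/
theorem GLn.awayFromPlaces_mul' (g h : GL (Fin n) (AdeleRing (𝓞 K) K)) :
    GLn.awayFromPlaces n K S (g * h) = GLn.awayFromPlaces n K S g * GLn.awayFromPlaces n K S h :=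
  GLn.awayFromPlaces_mul g h

/-- Archimedean elements `a = GLn.ofInfinite x` are trivial at the places of `S`. [folklore] -/
theorem GLn.ofInfinite_mem_trivialAt (x : GL (Fin n) (mixedSpace K)) :
    GLn.ofInfinite n K x ∈ GLn.trivialAt n K S :=
  GLn.mem_trivialAt_iff.2 fun _ _ => GLn.toLocalAt_ofInfinite x

/-- `s_S(a) = a` for archimedean `a = GLn.ofInfinite x`. [folklore] -/
theorem GLn.awayFromPlaces_ofInfinite (x : GL (Fin n) (mixedSpace K)) :
    GLn.awayFromPlaces n K S (GLn.ofInfinite n K x) = GLn.ofInfinite n K x :=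
  GLn.awayFromPlaces_eq_self_of_mem (GLn.ofInfinite_mem_trivialAt x)

/-- `(g a)_S = g_S` for archimedean `a`. [folklore] -/
theorem GLn.localPi_toLocalAt_mul_ofInfinite (g : (AdelicGroupData.gl n K).Adelic)
    (x : GL (Fin n) (mixedSpace K)) :
    (fun v : S => GLn.toLocalAt n K (v : HeightOneSpectrum (𝓞 K))
        (@HMul.hMul (AdelicGroupData.gl n K).Adelic (AdelicGroupData.gl n K).Adelic
          (AdelicGroupData.gl n K).Adelic instHMul g (GLn.ofInfinite n K x))) =
      fun v : S => GLn.toLocalAt n K (v : HeightOneSpectrum (𝓞 K)) g :=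
  funext fun _ => by rw [map_mul, GLn.toLocalAt_ofInfinite, mul_one]

/-- **`ι_S(u_S) ∈ K(𝔫)` for `u ∈ K(𝔫)`** (each `ι_v(u_v)` is, and `K(𝔫)` is a subgroup). [folklore] -/
theorem GLn.toAdelicPi_toLocalAt_mem_principalCongruenceLevel {𝔫 : Ideal (𝓞 K)}
    {u : GL (Fin n) (AdeleRing (𝓞 K) K)} (hu : u ∈ principalCongruenceLevel n K 𝔫) :
    GLn.toAdelicPi n K S (fun v : S => GLn.toLocalAt n K (v : HeightOneSpectrum (𝓞 K)) u) ∈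
      principalCongruenceLevel n K 𝔫 := by
  rw [GLn.toAdelicPi_apply]
  exact Subgroup.noncommProd_mem _ _ fun v _ => GLn.ofLocal_toLocalAt_mem_principalCongruenceLevel hu

/-- **`s_S(u) ∈ K(𝔫)` for `u ∈ K(𝔫)`.** [folklore] -/
theorem GLn.awayFromPlaces_mem_principalCongruenceLevel {𝔫 : Ideal (𝓞 K)}
    {u : GL (Fin n) (AdeleRing (𝓞 K) K)} (hu : u ∈ principalCongruenceLevel n K 𝔫) :
    GLn.awayFromPlaces n K S u ∈ principalCongruenceLevel n K 𝔫 :=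
  mul_mem hu (inv_mem (GLn.toAdelicPi_toLocalAt_mem_principalCongruenceLevel hu))

/-- For `w ∈ S`, the `S`-components of `ι_w(u)` form the element `u` placed at `w`
(`Pi.mulSingle`). [folklore] -/
theorem GLn.localPi_toLocalAt_toAdelic_of_mem {w : HeightOneSpectrum (𝓞 K)} (hw : w ∈ S)
    (u : GL (Fin n) (w.adicCompletion K)) :
    (fun v : S => GLn.toLocalAt n K (v : HeightOneSpectrum (𝓞 K)) (GLn.toAdelic n K w u)) =
      Pi.mulSingle (⟨w, hw⟩ : S) u := by
  funext v
  by_cases hv : v = ⟨w, hw⟩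
  · subst hv
    rw [Pi.mulSingle_eq_same]
    exact GLn.toLocal_toAdelic u
  · rw [Pi.mulSingle_eq_of_ne hv]
    have hvw : w ≠ (v : HeightOneSpectrum (𝓞 K)) := fun h => hv (Subtype.ext h.symm)
    exact GLn.toLocalAt_toAdelic_of_ne hvw u

/-- `ι_S(u placed at w) = ι_w(u)` for `w ∈ S`. [folklore] -/
theorem GLn.toAdelicPi_mulSingle {w : HeightOneSpectrum (𝓞 K)} (hw : w ∈ S)
    (u : GL (Fin n) (w.adicCompletion K)) :
    GLn.toAdelicPi n K S (Pi.mulSingle (⟨w, hw⟩ : S) u) = GLn.toAdelic n K w u := by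
  unfold GLn.toAdelicPi
  exact MonoidHom.noncommPiCoprod_mulSingle
    (fun v : S => GLn.toAdelic n K (v : HeightOneSpectrum (𝓞 K))) (⟨w, hw⟩ : S) u

/-- **`s_S(ι_w u) = 1` for `w ∈ S`.** [folklore] -/
theorem GLn.awayFromPlaces_toAdelic_of_mem {w : HeightOneSpectrum (𝓞 K)} (hw : w ∈ S)
    (u : GL (Fin n) (w.adicCompletion K)) :
    GLn.awayFromPlaces n K S (GLn.toAdelic n K w u) = 1 := by
  rw [show GLn.awayFromPlaces n K S (GLn.toAdelic n K w u) = GLn.toAdelic n K w u *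
      (GLn.toAdelicPi n K S fun v : S =>
        GLn.toLocalAt n K (v : HeightOneSpectrum (𝓞 K)) (GLn.toAdelic n K w u))⁻¹ from rfl,
    GLn.localPi_toLocalAt_toAdelic_of_mem hw, GLn.toAdelicPi_mulSingle hw, mul_inv_cancel]

end Algebra

/-! ### The glue: `θ^S ⊗ c` is a test function -/

section Glue

variable {n : ℕ} {K : Type} [Field K] [NumberField K] {S : Finset (HeightOneSpectrum (𝓞 K))}

open scoped Matrix.Norms.Operator in
/-- **`g ↦ θ(s_S g) c(g_S)` is a test function** for `θ` a test function on `GL_n(𝔸_K)` and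
`c : G_S → ℝ` right invariant under an open subgroup `U_c` of `G_S = ∏_{v ∈ S} GL_n(K_v)` and of
compact support (Garrett (2018), §7.3: `f_∞ ⊗ f_fin` with `f_fin` locally constant): continuity and
compact support are clear; archimedean smoothness at `g` is that of `θ` at `s_S(g)` since
archimedean elements `a` are trivial at the places of `S` (`s_S(g a) = s_S(g) a`, `(g a)_S = g_S`);
a level is `K(𝔫) ≤ U_θ` with `K(𝔫)_S ⊆ U_c`, for which `s_S(g u) = s_S(g) s_S(u)` with
`s_S(u) ∈ K(𝔫) ≤ U_θ`. [cite: Garrett2018, §6.3 (PDF pp. 274–275)] -/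
theorem IsTestFunctionGL.awayFromPlaces_mul_localPi {θ : GL (Fin n) (AdeleRing (𝓞 K) K) → ℝ}
    (hθ : IsTestFunctionGL n K θ) {c : GLn.LocalPi n K S → ℝ}
    {Uc : Subgroup (GLn.LocalPi n K S)} (hUo : IsOpen (Uc : Set (GLn.LocalPi n K S)))
    (hcU : ∀ (x : GLn.LocalPi n K S), ∀ k ∈ Uc, c (x * k) = c x) (hcs : HasCompactSupport c) :
    IsTestFunctionGL n K (fun g => θ (GLn.awayFromPlaces n K S g) *
      c (fun v : S => GLn.toLocalAt n K (v : HeightOneSpectrum (𝓞 K)) g)) := by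
  haveI : T2Space (AdelicGroupData.gl n K).Adelic := t2Space_gl n K
  have hcc : Continuous c := continuous_of_right_invariant hUo hcU
  have hpc : Continuous fun g : (AdelicGroupData.gl n K).Adelic =>
      (fun v : S => GLn.toLocalAt n K (v : HeightOneSpectrum (𝓞 K)) g) :=
    continuous_pi fun v : S => GLn.continuous_toLocalAt n K (v : HeightOneSpectrum (𝓞 K))
  refine ⟨?_, ?_, ?_, ?_⟩
  · -- continuity
    exact (hθ.continuous.comp (GLn.continuous_awayFromPlaces n K S)).mul (hcc.comp hpc)
  · -- compact support: inside `ι_S(tsupport c) · tsupport θ`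
    refine HasCompactSupport.intro
      ((hcs.isCompact.image (GLn.continuous_toAdelicPi n K S)).mul hθ.hasCompactSupport.isCompact)
      fun g hg => ?_
    by_contra hne
    have h1 : θ (GLn.awayFromPlaces n K S g) ≠ 0 := fun h0 => hne (by rw [h0, zero_mul])
    have h2 : c (fun v : S => GLn.toLocalAt n K (v : HeightOneSpectrum (𝓞 K)) g) ≠ 0 := fun h0 =>
      hne (by rw [h0, mul_zero])
    exact hg ⟨_, ⟨_, subset_tsupport _ h2, rfl⟩, GLn.awayFromPlaces n K S g, subset_tsupport _ h1,
      GLn.toAdelicPi_mul_awayFromPlaces g⟩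
  · -- archimedean smoothness: that of `θ` at `s_S(g)`, times the constant `c(g_S)`
    intro g
    have h := (hθ.isArchSmooth (GLn.awayFromPlaces n K S g)).const_smul
      ((c (fun v : S => GLn.toLocalAt n K (v : HeightOneSpectrum (𝓞 K)) g) : ℝ) : ℂ)
    convert h using 1
    funext X
    dsimp only
    rw [AutomorphyDatum.gl_ofArch_apply, GLn.localPi_toLocalAt_mul_ofInfinite, GLn.awayFromPlaces_mul,
      GLn.awayFromPlaces_ofInfinite, Complex.ofReal_mul, smul_eq_mul, mul_comm]
  · -- a level
    obtain ⟨Uθ, hUθ, hθU⟩ := hθ.exists_level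
    have hN : (fun g : (AdelicGroupData.gl n K).Adelic =>
        (fun v : S => GLn.toLocalAt n K (v : HeightOneSpectrum (𝓞 K)) g)) ⁻¹'
          (Uc : Set (GLn.LocalPi n K S)) ∈ 𝓝 (1 : GL (Fin n) (AdeleRing (𝓞 K) K)) :=
      hpc.continuousAt.preimage_mem_nhds (by
        have h1 : (fun v : S => GLn.toLocalAt n K (v : HeightOneSpectrum (𝓞 K))
            (1 : GL (Fin n) (AdeleRing (𝓞 K) K))) = 1 := funext fun _ => map_one _
        rw [h1]
        exact hUo.mem_nhds (one_mem Uc))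
    obtain ⟨𝔫, h𝔫, hle, hsub⟩ := exists_principalCongruenceLevel_le_of_mem_finiteLevelsGL hUθ hN
    refine ⟨principalCongruenceLevel n K 𝔫, principalCongruenceLevel_mem_finiteLevelsGL_holds n K h𝔫,
      fun u hu g => ?_⟩
    have huv : (fun v : S => GLn.toLocalAt n K (v : HeightOneSpectrum (𝓞 K)) u) ∈ Uc := hsub hu
    have h1 : c (fun v : S => GLn.toLocalAt n K (v : HeightOneSpectrum (𝓞 K)) (g * u)) =
        c (fun v : S => GLn.toLocalAt n K (v : HeightOneSpectrum (𝓞 K)) g) := by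
      rw [GLn.localPi_toLocalAt_mul']
      exact hcU _ _ huv
    have hsu : GLn.awayFromPlaces n K S u ∈ Uθ := hle (GLn.awayFromPlaces_mem_principalCongruenceLevel hu)
    have h2 : θ (GLn.awayFromPlaces n K S (g * u)) = θ (GLn.awayFromPlaces n K S g) := by
      rw [GLn.awayFromPlaces_mul']
      exact hθU _ hsu _
    change θ (GLn.awayFromPlaces n K S (g * u)) *
        c (fun v : S => GLn.toLocalAt n K (v : HeightOneSpectrum (𝓞 K)) (g * u)) =
      θ (GLn.awayFromPlaces n K S g) * c (fun v : S => GLn.toLocalAt n K (v : HeightOneSpectrum (𝓞 K)) g)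
    rw [h1, h2]

/-- **`θ^S ⊗ Ξ = η₁ + i η₂` with test functions `η₁`, `η₂`** for `θ` a test function and `Ξ` a
complex function on `G_S` right invariant under an open subgroup and of compact support
(`η₁ = θ(s_S ·) Re Ξ((·)_S)`, `η₂ = θ(s_S ·) Im Ξ((·)_S)`): the product test functions
`GLn.placesTestFunction S Ξ θ` are in the class for which `GLnSupercuspTypeHilbertSchmidt` /
`GL2TraceFormulaModParabolic` compute the Hilbert–Schmidt norm of `R(Φ)`.
[cite: Garrett2018, §6.3 (PDF pp. 274–275)] -/
theorem exists_isTestFunctionGL_placesTestFunction {θ : GL (Fin n) (AdeleRing (𝓞 K) K) → ℝ}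
    (hθ : IsTestFunctionGL n K θ) {Ξ : GLn.LocalPi n K S → ℂ}
    {U : Subgroup (GLn.LocalPi n K S)} (hUo : IsOpen (U : Set (GLn.LocalPi n K S)))
    (hΞU : ∀ (x : GLn.LocalPi n K S), ∀ k ∈ U, Ξ (x * k) = Ξ x) (hΞs : HasCompactSupport Ξ) :
    ∃ η₁ η₂ : GL (Fin n) (AdeleRing (𝓞 K) K) → ℝ, IsTestFunctionGL n K η₁ ∧ IsTestFunctionGL n K η₂ ∧
      ∀ g, GLn.placesTestFunction S Ξ (fun x => (θ x : ℂ)) g = η₁ g + η₂ g * Complex.I := by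
  refine ⟨fun g => θ (GLn.awayFromPlaces n K S g) *
      (Ξ (fun v : S => GLn.toLocalAt n K (v : HeightOneSpectrum (𝓞 K)) g)).re,
    fun g => θ (GLn.awayFromPlaces n K S g) *
      (Ξ (fun v : S => GLn.toLocalAt n K (v : HeightOneSpectrum (𝓞 K)) g)).im,
    hθ.awayFromPlaces_mul_localPi hUo (fun x k hk => by show (Ξ (x * k)).re = (Ξ x).re; rw [hΞU x k hk])
      (hΞs.comp_left Complex.zero_re),
    hθ.awayFromPlaces_mul_localPi hUo (fun x k hk => by show (Ξ (x * k)).im = (Ξ x).im; rw [hΞU x k hk])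
      (hΞs.comp_left Complex.zero_im),
    fun g => ?_⟩
  rw [GLn.placesTestFunction_apply]
  conv_lhs => rw [← Complex.re_add_im (Ξ fun v : S => GLn.toLocalAt n K (v : HeightOneSpectrum (𝓞 K)) g)]
  push_cast
  ring

end Glue

/-! ### Tensors `⊗_{v ∈ S} ξ_v` of locally constant factors -/

section Tensor

variable {n : ℕ} {K : Type} [Field K] [NumberField K] {S : Finset (HeightOneSpectrum (𝓞 K))}

/-- **`⊗ ξ_v` is right invariant under `∏_{v ∈ S} U_v`** when each `ξ_v` is right `U_v`-invariant.
[folklore] -/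
theorem GLn.tensorCc_mul_of_mem_pi
    (ξ : ∀ v : HeightOneSpectrum (𝓞 K), C_c(GL (Fin n) (v.adicCompletion K), ℂ))
    (U : ∀ v : HeightOneSpectrum (𝓞 K), Subgroup (GL (Fin n) (v.adicCompletion K)))
    (hU : ∀ v ∈ S, ∀ k ∈ U v, ∀ g, ξ v (g * k) = ξ v g) (x : GLn.LocalPi n K S) {k : GLn.LocalPi n K S}
    (hk : k ∈ Subgroup.pi Set.univ (fun v : S => U (v : HeightOneSpectrum (𝓞 K)))) :
    GLn.tensorCc S ξ (x * k) = GLn.tensorCc S ξ x := by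
  rw [GLn.tensorCc_apply, GLn.tensorCc_apply]
  exact Finset.prod_congr rfl fun v _ =>
    hU v v.2 (k v) ((Subgroup.mem_pi _).1 hk v (Set.mem_univ _)) (x v)

/-- The product `∏_{v ∈ S} U_v` of open subgroups is open in `G_S`. [folklore] -/
theorem GLn.isOpen_pi_localPi
    (U : ∀ v : HeightOneSpectrum (𝓞 K), Subgroup (GL (Fin n) (v.adicCompletion K)))
    (hUo : ∀ v ∈ S, IsOpen (U v : Set (GL (Fin n) (v.adicCompletion K)))) :
    IsOpen ((Subgroup.pi Set.univ (fun v : S => U (v : HeightOneSpectrum (𝓞 K))) :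
      Subgroup (GLn.LocalPi n K S)) : Set (GLn.LocalPi n K S)) := by
  rw [Subgroup.coe_pi]
  exact isOpen_set_pi Set.finite_univ fun v _ => hUo v v.2

/-- **If each `ξ_v` (`v ∈ S`) is invariant under an open subgroup, `⊗ ξ_v` is right invariant under
an open subgroup of `G_S`** — the shape delivered by `exists_ramifiedFactor_family`
(`SupercuspidalIdempotentLocalComponent`). [folklore] -/
theorem GLn.exists_isOpen_tensorCc_mul_eq
    (ξ : ∀ v : HeightOneSpectrum (𝓞 K), C_c(GL (Fin n) (v.adicCompletion K), ℂ))
    (hξ : ∀ w ∈ S, ∃ U : Subgroup (GL (Fin n) (w.adicCompletion K)),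
      IsOpen (U : Set (GL (Fin n) (w.adicCompletion K))) ∧
        ∀ k ∈ U, ∀ g, ξ w (k * g) = ξ w g ∧ ξ w (g * k) = ξ w g) :
    ∃ Uc : Subgroup (GLn.LocalPi n K S), IsOpen (Uc : Set (GLn.LocalPi n K S)) ∧
      ∀ (x : GLn.LocalPi n K S), ∀ k ∈ Uc, GLn.tensorCc S ξ (x * k) = GLn.tensorCc S ξ x := by
  choose! U hUo hU using hξ
  exact ⟨Subgroup.pi Set.univ (fun v : S => U (v : HeightOneSpectrum (𝓞 K))), GLn.isOpen_pi_localPi U hUo,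
    fun x k hk => GLn.tensorCc_mul_of_mem_pi ξ U (fun v hv k hk g => (hU v hv k hk g).2) x hk⟩

/-- **`(⊗ ξ_v) ⊗ θ = η₁ + i η₂` with test functions `η₁`, `η₂`** for `θ` a test function on
`GL_n(𝔸_K)` and `ξ_v ∈ C_c(GL_n(K_v))` (`v ∈ S`) each invariant under an open subgroup: Gelbart's
`Φ = (∏_{v ∈ S} f_v) × f` (p. 153) with locally constant ramified factors is a test function.
[cite: Garrett2018, §6.3 (PDF pp. 274–275)] -/
theorem exists_isTestFunctionGL_placesTestFunction_tensorCc {θ : GL (Fin n) (AdeleRing (𝓞 K) K) → ℝ}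
    (hθ : IsTestFunctionGL n K θ)
    (ξ : ∀ v : HeightOneSpectrum (𝓞 K), C_c(GL (Fin n) (v.adicCompletion K), ℂ))
    (hξ : ∀ w ∈ S, ∃ U : Subgroup (GL (Fin n) (w.adicCompletion K)),
      IsOpen (U : Set (GL (Fin n) (w.adicCompletion K))) ∧
        ∀ k ∈ U, ∀ g, ξ w (k * g) = ξ w g ∧ ξ w (g * k) = ξ w g) :
    ∃ η₁ η₂ : GL (Fin n) (AdeleRing (𝓞 K) K) → ℝ, IsTestFunctionGL n K η₁ ∧ IsTestFunctionGL n K η₂ ∧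
      ∀ g, GLn.placesTestFunction S (GLn.tensorCc S ξ) (fun x => (θ x : ℂ)) g = η₁ g + η₂ g * Complex.I := by
  obtain ⟨Uc, hUo, hU⟩ := GLn.exists_isOpen_tensorCc_mul_eq (S := S) ξ hξ
  exact exists_isTestFunctionGL_placesTestFunction hθ hUo hU (GLn.tensorCc S ξ).hasCompactSupport

end Tensor

/-! ### Supercusp type -/

section SupercuspType

variable {n k : ℕ} {K : Type} [Field K] [NumberField K] {S : Finset (HeightOneSpectrum (𝓞 K))}

/-- **`Φ_{⊗ξ,θ}(p ι_w(u) r) = θ(s_S p · s_S r) · ξ_w(p_w u r_w) · ∏_{v ∈ S, v ≠ w} ξ_v(p_v r_v)`**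
for `w ∈ S` (`s_S` is multiplicative and trivial on `ι_w(GL_n(K_w))`; `(ι_w u)_v = 1` for `v ≠ w`).
[folklore] -/
theorem GLn.placesTestFunction_tensorCc_mul_toAdelic_mul (θ : (AdelicGroupData.gl n K).Adelic → ℂ)
    (ξ : ∀ v : HeightOneSpectrum (𝓞 K), C_c(GL (Fin n) (v.adicCompletion K), ℂ))
    {w : HeightOneSpectrum (𝓞 K)} (hw : w ∈ S) (p r : (AdelicGroupData.gl n K).Adelic)
    (u : GL (Fin n) (w.adicCompletion K)) :
    GLn.placesTestFunction S (GLn.tensorCc S ξ) θ (p * GLn.toAdelic n K w u * r) =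
      θ (GLn.awayFromPlaces n K S p * GLn.awayFromPlaces n K S r) *
        (ξ w (GLn.toLocalAt n K w p * u * GLn.toLocalAt n K w r) *
          ∏ v ∈ (Finset.univ : Finset S).erase ⟨w, hw⟩,
            ξ v (GLn.toLocalAt n K (v : HeightOneSpectrum (𝓞 K)) p *
              GLn.toLocalAt n K (v : HeightOneSpectrum (𝓞 K)) r)) := by
  rw [GLn.placesTestFunction_apply, GLn.awayFromPlaces_mul, GLn.awayFromPlaces_mul,
    GLn.awayFromPlaces_toAdelic_of_mem hw, mul_one, GLn.tensorCc_apply,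
    ← Finset.mul_prod_erase (Finset.univ : Finset S) _ (Finset.mem_univ (⟨w, hw⟩ : S))]
  congr 2
  · change ξ w (GLn.toLocalAt n K w (p * GLn.toAdelic n K w u * r)) = _
    rw [map_mul (GLn.toLocalAt n K w), map_mul (GLn.toLocalAt n K w), GLn.toLocal_toAdelic]
  · refine Finset.prod_congr rfl fun v hv => ?_
    have hvw : w ≠ (v : HeightOneSpectrum (𝓞 K)) := fun h =>
      (Finset.mem_erase.1 hv).1 (Subtype.ext h.symm)
    rw [map_mul (GLn.toLocalAt n K (v : HeightOneSpectrum (𝓞 K))),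
      map_mul (GLn.toLocalAt n K (v : HeightOneSpectrum (𝓞 K))), GLn.toLocalAt_toAdelic_of_ne hvw u, mul_one]

/-- **`(⊗ ξ_v) ⊗ θ` is of supercusp type at level `k` as soon as one `ξ_w` (`w ∈ S`) is**: if
`∫_{𝔫_k(K_w)} ξ_w(a (1 + Y) b) dY = 0` for all `a, b ∈ GL_n(K_w)`, then
`∫_{𝔫_k(𝔸_K)} Φ_{⊗ξ,θ}(p (1 + Y) r) dν(Y) = 0` for every additive Haar measure `ν` of `𝔫_k(𝔸_K)`
and all `p, r ∈ GL_n(𝔸_K)` — the hypothesis `(H_k)` of `SupercuspTypeCuspidalImage` /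
`GL2TraceFormulaModParabolic` (`integral_comp_glUnipotent_eq_zero_of_place` and the factorisation
`GLn.placesTestFunction_tensorCc_mul_toAdelic_mul`; Jacquet–Langlands (1970), p. 503).
[cite: JacquetLanglands1970, §16 p. 503] -/
theorem integral_placesTestFunction_tensorCc_comp_glUnipotent_eq_zero
    {θ : (AdelicGroupData.gl n K).Adelic → ℂ} (hθ : Continuous θ) (hθs : HasCompactSupport θ)
    (ξ : ∀ v : HeightOneSpectrum (𝓞 K), C_c(GL (Fin n) (v.adicCompletion K), ℂ))
    {w : HeightOneSpectrum (𝓞 K)} (hw : w ∈ S)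
    [MeasurableSpace (blockNilpotent n k (w.adicCompletion K))]
    [BorelSpace (blockNilpotent n k (w.adicCompletion K))]
    (αw : Measure (blockNilpotent n k (w.adicCompletion K))) [αw.IsAddHaarMeasure]
    (hξ0 : ∀ a b : GL (Fin n) (w.adicCompletion K),
      ∫ Y, ξ w (a * unipotentOfBlock n k (w.adicCompletion K) (Multiplicative.ofAdd Y) * b) ∂αw = 0)
    (ν : Measure (blockNilpotent n k (AdeleRing (𝓞 K) K))) [ν.IsAddHaarMeasure]
    (p r : (AdelicGroupData.gl n K).Adelic) :
    ∫ Y, GLn.placesTestFunction S (GLn.tensorCc S ξ) θ (p * glUnipotent n k K (Multiplicative.ofAdd Y) * r) ∂ν = 0 := by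
  refine integral_comp_glUnipotent_eq_zero_of_place w (GLn.toAdelic n K w) (fun _ => rfl)
    (GLn.continuous_placesTestFunction (GLn.tensorCc S ξ).continuous hθ)
    (GLn.hasCompactSupport_placesTestFunction (GLn.tensorCc S ξ).hasCompactSupport hθs) αw
    (fun p r => ?_) ν p r
  -- `∫ C ξ_w(p_w n(Y) r_w) C' dY = C C' (∫ ξ_w(…) dY) = 0`
  have h1 : ∀ Y : blockNilpotent n k (w.adicCompletion K),
      GLn.placesTestFunction S (GLn.tensorCc S ξ) θ
          (p * GLn.toAdelic n K w (unipotentOfBlock n k (w.adicCompletion K) (Multiplicative.ofAdd Y)) * r) =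
      (θ (GLn.awayFromPlaces n K S p * GLn.awayFromPlaces n K S r) *
        ∏ v ∈ (Finset.univ : Finset S).erase ⟨w, hw⟩,
            ξ v (GLn.toLocalAt n K (v : HeightOneSpectrum (𝓞 K)) p *
              GLn.toLocalAt n K (v : HeightOneSpectrum (𝓞 K)) r)) *
        ξ w (GLn.toLocalAt n K w p * unipotentOfBlock n k (w.adicCompletion K) (Multiplicative.ofAdd Y) *
            GLn.toLocalAt n K w r) := fun Y => by
    rw [GLn.placesTestFunction_tensorCc_mul_toAdelic_mul θ ξ hw]
    ring
  refine (integral_congr_ae (Eventually.of_forall h1)).trans ?_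
  rw [integral_const_mul, hξ0, mul_zero]

end SupercuspType

end Literature.NumberTheory.Automorphic
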